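import Mathlib
import Literature.LinearAlgebra.Matrix.WronskianDerivation
import HarnessLib

/-!
# The `K`-determinant of a `K = ℚ(√-d)`-linear endomorphism of a rational space lies in `K`

Family `hodge`, layer `Literature/AlgebraicGeometry/HodgeTheory`. A pure linear-algebra helper.
Let `V` be a finite-dimensional complex vector space with a basis `b` in which two endomorphisms
`J`, `M` have *rational* matrices, let `d > 0` and let `μ ∈ ℂ` with `μ ^ 2 = -d` (so
`μ = ± i √d`). Put `P₊ = (2μ)⁻¹ (J + μ)` and `P₋ = (2μ)⁻¹ (μ - J)`; when `J ^ 2 = -d` these are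
the two spectral projectors of `J` (onto the `± μ`-eigenspaces `V±`), and
`det (M P₊ + P₋) = det (M|V₊)` for `M` commuting with `J`. We prove
(`det_comp_proj_add_proj_mem`) that `det (M P₊ + P₋)` lies in the imaginary quadratic field
`ℚ(μ) = ℚ + ℚ μ ⊆ ℂ`: the set `ℚ + ℚ μ` is a subring of `ℂ` (as `μ * μ = -d`) containing `μ`,
`(2μ)⁻¹ = -μ / (2d)` and all rationals, hence all entries of the matrix of `M P₊ + P₋` in the
basis `b`, hence its determinant (`Literature.LinearAlgebra.Matrix.det_mem_of_forall_mem`, the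
tree's "a determinant with entries in a subring lies in the subring"). Informally: the
`K`-determinant of a `K`-linear endomorphism of a rational vector space with a `K = ℚ(√-d)`-action
lies in `K`.

It is used for the flatness of the Weil lines in the anchoring family for Weil classes: the
monodromy `γ` on `H¹ = V₊ ⊕ V₋` is integral and commutes with the `√-d`-action, so
`det (γ|V₊) ∈ ℚ(√-d)`, a step of "level-`n` structure forces special unitary monodromy"
(van Geemen, 5.8–5.11).

## References

* [vanGeemen1994HodgeAV] B. van Geemen, An introduction to the Hodge conjecture for abelian
  varieties, in: Algebraic Cycles and Hodge Theory (Torino 1993), LNM 1594, Springer 1994, 5.8–5.11.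
-/

namespace Literature.AlgebraicGeometry.HodgeTheory

variable {V : Type*} [AddCommGroup V] [Module ℂ V]
variable {ι : Type*} [Fintype ι] [DecidableEq ι]

/-- **The determinant of `M P₊ + P₋` lies in `ℚ + ℚ μ`.** Let `J`, `M` be endomorphisms of a
finite-dimensional complex vector space whose matrices in some basis `b` are rational, let
`0 < d` and `μ ^ 2 = -d`. Then, with `P₊ = (2μ)⁻¹ (J + μ)` and `P₋ = (2μ)⁻¹ (μ - J)` (the
spectral projectors of `J` when `J ^ 2 = -d`), the determinant of `M P₊ + P₋` is of the form
`x + y μ` with `x y : ℚ`, i.e. lies in the imaginary quadratic field `ℚ(μ) = ℚ(√-d)`: all entries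
of its matrix in the basis `b` lie in the subring `ℚ + ℚ μ` of `ℂ`. Informally: the
`K`-determinant of a `K = ℚ(√-d)`-linear endomorphism of a rational vector space lies in `K`.
[folklore] -/
theorem det_comp_proj_add_proj_mem (b : Module.Basis ι ℂ V) (J M : Module.End ℂ V)
    (Jq Mq : Matrix ι ι ℚ) (hJ : LinearMap.toMatrix b b J = Jq.map (algebraMap ℚ ℂ))
    (hM : LinearMap.toMatrix b b M = Mq.map (algebraMap ℚ ℂ))
    {d : ℕ} (hd : 0 < d) (μ : ℂ) (hμ : μ ^ 2 = -(d : ℂ)) :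
    ∃ x y : ℚ, LinearMap.det (M ∘ₗ ((2 * μ)⁻¹ • (J + μ • 1)) + (2 * μ)⁻¹ • (μ • 1 - J)) =
      (x : ℂ) + (y : ℂ) * μ := by
  have hμμ : μ * μ = -(d : ℂ) := by rw [← sq, hμ]
  -- `S = ℚ + ℚ μ` is a subring of `ℂ`, since `μ * μ = -d`.
  let S : Subring ℂ :=
    { carrier := {z | ∃ x y : ℚ, z = x + y * μ}
      mul_mem' := by
        rintro _ _ ⟨x, y, rfl⟩ ⟨x', y', rfl⟩
        refine ⟨x * x' - d * (y * y'), x * y' + x' * y, ?_⟩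
        push_cast
        linear_combination ((y : ℂ) * y') * hμμ
      one_mem' := ⟨1, 0, by simp⟩
      add_mem' := by
        rintro _ _ ⟨x, y, rfl⟩ ⟨x', y', rfl⟩
        exact ⟨x + x', y + y', by push_cast; ring⟩
      zero_mem' := ⟨0, 0, by simp⟩
      neg_mem' := by
        rintro _ ⟨x, y, rfl⟩
        exact ⟨-x, -y, by push_cast; ring⟩ }
  have hμS : μ ∈ S := ⟨0, 1, by simp⟩
  have hqS : ∀ q : ℚ, algebraMap ℚ ℂ q ∈ S := fun q => ⟨q, 0, by simp⟩
  have h1S : ∀ k l, (1 : Matrix ι ι ℂ) k l ∈ S := fun k l => by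
    rw [Matrix.one_apply]
    split_ifs
    exacts [one_mem S, zero_mem S]
  -- `(2μ)⁻¹ = -μ / (2d) ∈ S`.
  have hd0 : (d : ℂ) ≠ 0 := Nat.cast_ne_zero.mpr hd.ne'
  have hμinv : μ⁻¹ = -(d : ℂ)⁻¹ * μ := by
    refine inv_eq_of_mul_eq_one_right ?_
    calc μ * (-(d : ℂ)⁻¹ * μ) = -(μ * μ) * (d : ℂ)⁻¹ := by ring
      _ = 1 := by rw [hμμ, neg_neg, mul_inv_cancel₀ hd0]
  have hcS : (2 * μ)⁻¹ ∈ S :=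
    ⟨0, -(1 / (2 * d)), by rw [mul_inv_rev, hμinv]; push_cast; ring⟩
  -- Pass to matrices in the basis `b`.
  rw [← LinearMap.det_toMatrix b]
  have hA : LinearMap.toMatrix b b (M ∘ₗ ((2 * μ)⁻¹ • (J + μ • 1)) + (2 * μ)⁻¹ • (μ • 1 - J)) =
      Mq.map (algebraMap ℚ ℂ) * ((2 * μ)⁻¹ • (Jq.map (algebraMap ℚ ℂ) + μ • 1)) +
        (2 * μ)⁻¹ • (μ • 1 - Jq.map (algebraMap ℚ ℂ)) := by
    simp only [map_add, map_sub, map_smul, LinearMap.toMatrix_comp b b b,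
      LinearMap.toMatrix_one, hJ, hM]
  -- All entries of this matrix lie in `S`, hence so does its determinant.
  have hentry : ∀ i j, (Mq.map (algebraMap ℚ ℂ) * ((2 * μ)⁻¹ • (Jq.map (algebraMap ℚ ℂ) + μ • 1)) +
      (2 * μ)⁻¹ • (μ • 1 - Jq.map (algebraMap ℚ ℂ))) i j ∈ S := by
    intro i j
    simp only [Matrix.add_apply, Matrix.mul_apply, Matrix.smul_apply, Matrix.sub_apply,
      Matrix.map_apply, smul_eq_mul]
    refine add_mem (sum_mem fun k _ => ?_) ?_
    · exact mul_mem (hqS _) (mul_mem hcS (add_mem (hqS _) (mul_mem hμS (h1S _ _))))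
    · exact mul_mem hcS (sub_mem (mul_mem hμS (h1S _ _)) (hqS _))
  rw [hA]
  obtain ⟨x, y, hxy⟩ := Literature.LinearAlgebra.Matrix.det_mem_of_forall_mem S _ hentry
  exact ⟨x, y, hxy⟩

end Literature.AlgebraicGeometry.HodgeTheory
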